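import Summits.QuantumFields.YangMills.Theorems.BalabanUVNodesN07DirectMethod
import Mathlib.Analysis.SpecialFunctions.Trigonometric.Basic
import HarnessLib

/-!
# Route `UnitScaleTilt`, crux K1 child «MinimiserStabilityRegPr» (stmt-QuantumFields-19200), skeleton v10, stub `stub_existenceMinimalOrbit` (EX),
# DENSITY line (★★OWNER RULING g28-№8 (B)) — **THE `SU(2)` ALGEBRA OF THE DENSITY ROW (D3): (i) the joint commutant of two NON-COMMUTING `2 × 2`
# matrices is `ℂ·1`; (ii) next to ANY pair `h₁, h₂ ∈ SU(2)` there are pairs `r₁(s)·h₁, r₂(s)·h₂` that do NOT commute, along two explicit continuous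
# one-parameter families `r₁, r₂ : ℝ → SU(2)` through `1` (`s ∈ (0, 1)`)**

Cell `ym3-torus`, width seat `ym3-torus-px10` (gen 3).  THEOREMS ONLY (0 `def`, 0 `sorry`).  `--supports stmt-QuantumFields-19200 --as helper`,
count-neutral.  YM₃ on T³ is a ladder rung (R3), not the Clay problem; nothing here claims the stub, the crux, d = 4 or the mass gap.

WHY.  The DENSITY road for the reducible-`V` sector of EX (✓-candidate `…Prop7ExistenceByDensityLimit`, LOCATE memo `LOCATE-DENSITY-px10g3.md`) needs
«irreducible coarse fields are DENSE»: a coarse `SU(2)` field `V` is irreducible (every `V`-parallel `M₂(ℂ)`-section is scalar) as soon as two plaquette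
holonomies at one site do not commute — (i) below; and two plaquette holonomies `h₁, h₂` at a site are made non-commuting by left-multiplying the variables
of two distinct bonds by `r₁(s), r₂(s)` with `s` arbitrarily small — (ii) below.  The lattice half is the sibling file `…Prop7IrreducibleCoarseFieldsDense`.

WHAT IS PROVED (sorry-free, no definition; ns `…Theorems.Prop7SU2NonCommutingPairs`):
* §1 ★ `exists_eq_smul_one_of_commute_of_not_commute` — `M A = A M`, `M B = B M`, `A B ≠ B A` (all in `M₂(ℂ)`) ⇒ `M = z • 1` (the commutant of a non-scalar
  `2 × 2` matrix `A` is `span{1, A}`, by the four entry equations; then `β·[A, B] = 0`).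
* §2 the two families, INLINE (no `def`): `P(s) := !![cos s, I·sin s; I·sin s, cos s]`, `D(s) := !![cos s + I·sin s, 0; 0, cos s − I·sin s]`, both in
  `SU(2)` (`P_mem`, `D_mem`), continuous in `s`, `= 1` at `s = 0`; for `sin s ≠ 0`: `D(s)·P(s) ≠ P(s)·D(s)`; a matrix commuting with `D(s)` is diagonal; a
  matrix commuting with `P(s)` has equal diagonal and equal off-diagonal entries; hence a matrix commuting with both is scalar.
* §3 ★★ `exists_nonCommuting_near` — for all `h₁ h₂ : SU(2)`: `∃ r₁ r₂ : ℝ → SU(2)`, continuous, `r₁ 0 = 1`, `r₂ 0 = 1`, and for every `s ∈ (0, 1)`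
  the matrices `r₁(s)·h₁` and `r₂(s)·h₂` do not commute (six-way case split on `[h₁, h₂]`, the `P`∕`D`-commutation type of `h₂`, then of `h₁`; each
  `rᵢ ∈ {1, P, D}`).

HONEST SCOPE.  Elementary linear algebra; nothing of [Balaban1985Variational] is asserted; no stub ∕ crux statement is advanced; YM₃ on T³ = rung R3 — not
d = 4, not infinite volume, not a mass gap, not Clay.

References: T. Bałaban, CMP 102 (1985) 277–309 [Balaban1985Variational] (Prop. 7 p.299 — the existence clause this line serves; bookkeeping).
-/

set_option autoImplicit false

noncomputable section

open Complex

namespace Summit.QuantumFields.YangMills.Theorems.Prop7SU2NonCommutingPairs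

/-! ## §1 ★ The joint commutant of a non-commuting pair of `2 × 2` matrices is `ℂ·1` -/

/-- Entry expansion of a `2 × 2` product. [folklore] -/
theorem mul_apply_two (M A : Matrix (Fin 2) (Fin 2) ℂ) (i j : Fin 2) : (M * A) i j = M i 0 * A 0 j + M i 1 * A 1 j := by
  rw [Matrix.mul_apply, Fin.sum_univ_two]

/-- A `2 × 2` matrix with vanishing off-diagonal entries and equal diagonal entries is scalar. [folklore] -/
theorem eq_smul_one_of_entries {M : Matrix (Fin 2) (Fin 2) ℂ} (h01 : M 0 1 = 0) (h10 : M 1 0 = 0) (h11 : M 1 1 = M 0 0) :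
    M = M 0 0 • (1 : Matrix (Fin 2) (Fin 2) ℂ) := by
  ext i j
  fin_cases i <;> fin_cases j <;> simp [h01, h10, h11]

/-- Entries of `α·1 + β·A`. [folklore] -/
theorem smul_one_add_smul_apply (α β : ℂ) (A : Matrix (Fin 2) (Fin 2) ℂ) (i j : Fin 2) :
    (α • (1 : Matrix (Fin 2) (Fin 2) ℂ) + β • A) i j = (if i = j then α else 0) + β * A i j := by
  simp only [Matrix.add_apply, Matrix.smul_apply, Matrix.one_apply, smul_eq_mul, mul_ite, mul_one, mul_zero]

/-- **THE COMMUTANT OF A NON-SCALAR `2 × 2` MATRIX IS `span{1, A}`**: if `M A = A M` and `A` is not scalar then `M = α·1 + β·A`. [folklore] -/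
theorem exists_eq_smul_one_add_smul_of_commute {M A : Matrix (Fin 2) (Fin 2) ℂ} (hA : M * A = A * M)
    (hns : ¬ (A 0 1 = 0 ∧ A 1 0 = 0 ∧ A 1 1 = A 0 0)) :
    ∃ α β : ℂ, M = α • (1 : Matrix (Fin 2) (Fin 2) ℂ) + β • A := by
  have e00 := congrFun (congrFun hA 0) 0
  have e01 := congrFun (congrFun hA 0) 1
  have e10 := congrFun (congrFun hA 1) 0
  have e11 := congrFun (congrFun hA 1) 1
  simp only [mul_apply_two] at e00 e01 e10 e11
  -- it suffices to produce `β` with the three entry identities; `α := M 0 0 − β·A 0 0`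
  suffices hβ : ∃ β : ℂ, M 0 1 = β * A 0 1 ∧ M 1 0 = β * A 1 0 ∧ M 1 1 = M 0 0 - β * A 0 0 + β * A 1 1 by
    obtain ⟨β, h1, h2, h3⟩ := hβ
    refine ⟨M 0 0 - β * A 0 0, β, ?_⟩
    ext i j
    rw [smul_one_add_smul_apply]
    fin_cases i <;> fin_cases j
    · simp
    · simpa using h1
    · simpa using h2
    · simpa using h3
  by_cases hb : A 0 1 = 0
  · by_cases hc : A 1 0 = 0
    · -- `A` diagonal and, by `hns`, `A 0 0 ≠ A 1 1`
      have had : A 1 1 ≠ A 0 0 := fun h => hns ⟨hb, hc, h⟩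
      have hsub : A 0 0 - A 1 1 ≠ 0 := sub_ne_zero.mpr (Ne.symm had)
      have hq : M 0 1 = 0 := by
        rw [hb] at e01
        have : M 0 1 * (A 0 0 - A 1 1) = 0 := by linear_combination -e01
        exact (mul_eq_zero.mp this).resolve_right hsub
      have hr : M 1 0 = 0 := by
        rw [hc] at e10
        have : M 1 0 * (A 0 0 - A 1 1) = 0 := by linear_combination e10
        exact (mul_eq_zero.mp this).resolve_right hsub
      refine ⟨(M 0 0 - M 1 1) / (A 0 0 - A 1 1), by rw [hb, hq, mul_zero], by rw [hc, hr, mul_zero], ?_⟩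
      rw [sub_add, ← mul_sub, div_mul_cancel₀ _ hsub]
      ring
    · -- `A 1 0 ≠ 0`: `β := M 1 0 / A 1 0`
      refine ⟨M 1 0 / A 1 0, ?_, by rw [div_mul_cancel₀ _ hc], ?_⟩
      · rw [div_mul_eq_mul_div, eq_div_iff hc]
        linear_combination -e11
      · have key : M 1 0 * (A 1 1 - A 0 0) = (M 1 1 - M 0 0) * A 1 0 := by linear_combination -e10
        calc M 1 1 = M 0 0 + (M 1 1 - M 0 0) * A 1 0 / A 1 0 := by rw [mul_div_cancel_right₀ _ hc]; ring
          _ = M 0 0 + M 1 0 * (A 1 1 - A 0 0) / A 1 0 := by rw [key]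
          _ = M 0 0 - M 1 0 / A 1 0 * A 0 0 + M 1 0 / A 1 0 * A 1 1 := by ring
  · -- `A 0 1 ≠ 0`: `β := M 0 1 / A 0 1`
    refine ⟨M 0 1 / A 0 1, by rw [div_mul_cancel₀ _ hb], ?_, ?_⟩
    · rw [div_mul_eq_mul_div, eq_div_iff hb]
      linear_combination -e00
    · have key : M 0 1 * (A 1 1 - A 0 0) = (M 1 1 - M 0 0) * A 0 1 := by linear_combination e01
      calc M 1 1 = M 0 0 + (M 1 1 - M 0 0) * A 0 1 / A 0 1 := by rw [mul_div_cancel_right₀ _ hb]; ring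
        _ = M 0 0 + M 0 1 * (A 1 1 - A 0 0) / A 0 1 := by rw [key]
        _ = M 0 0 - M 0 1 / A 0 1 * A 0 0 + M 0 1 / A 0 1 * A 1 1 := by ring

/-- ★ **THE JOINT COMMUTANT OF A NON-COMMUTING PAIR IS `ℂ·1`**: `M A = A M`, `M B = B M`, `A B ≠ B A` ⇒ `M = z • 1`. [folklore] -/
theorem exists_eq_smul_one_of_commute_of_not_commute {M A B : Matrix (Fin 2) (Fin 2) ℂ} (hA : M * A = A * M) (hB : M * B = B * M)
    (hAB : A * B ≠ B * A) : ∃ z : ℂ, M = z • (1 : Matrix (Fin 2) (Fin 2) ℂ) := by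
  have hns : ¬ (A 0 1 = 0 ∧ A 1 0 = 0 ∧ A 1 1 = A 0 0) := by
    rintro ⟨h01, h10, h11⟩
    apply hAB
    rw [eq_smul_one_of_entries h01 h10 h11, smul_mul_assoc, one_mul, mul_smul_comm, mul_one]
  obtain ⟨α, β, hM⟩ := exists_eq_smul_one_add_smul_of_commute hA hns
  have hcomm : β • (A * B - B * A) = 0 := by
    have h1 : M * B = α • B + β • (A * B) := by rw [hM, add_mul, smul_mul_assoc, one_mul, smul_mul_assoc]
    have h2 : B * M = α • B + β • (B * A) := by rw [hM, mul_add, mul_smul_comm, mul_one, mul_smul_comm]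
    rw [smul_sub, sub_eq_zero, ← add_left_cancel_iff (a := α • B), ← h1, ← h2, hB]
  rcases smul_eq_zero.mp hcomm with hβ | hzero
  · exact ⟨α, by rw [hM, hβ, zero_smul, add_zero]⟩
  · exact absurd (sub_eq_zero.mp hzero) hAB

/-! ## §2 Two one-parameter families in `SU(2)` through `1` and their commutation types

`P(s) := !![cos s, I·sin s; I·sin s, cos s]` and `D(s) := !![cos s + I·sin s, 0; 0, cos s − I·sin s]` (written INLINE; no `def`). -/

/-- `cos² + sin² = 1` in `ℂ`. [folklore] -/
theorem cos_mul_cos_add_sin_mul_sin (s : ℝ) : (Real.cos s : ℂ) * Real.cos s + (Real.sin s : ℂ) * Real.sin s = 1 := by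
  have h := Real.cos_sq_add_sin_sq s
  have h' : Real.cos s * Real.cos s + Real.sin s * Real.sin s = 1 := by nlinarith [h]
  exact_mod_cast h'

/-- `P(s) ∈ SU(2)`. [folklore] -/
theorem P_mem (s : ℝ) :
    !![(Real.cos s : ℂ), I * Real.sin s; I * Real.sin s, (Real.cos s : ℂ)] ∈ Matrix.specialUnitaryGroup (Fin 2) ℂ := by
  have hcs := cos_mul_cos_add_sin_mul_sin s
  rw [Matrix.mem_specialUnitaryGroup_iff, Matrix.mem_unitaryGroup_iff]
  refine ⟨?_, ?_⟩
  · ext i j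
    fin_cases i <;> fin_cases j <;>
      simp only [Fin.zero_eta, Fin.mk_one, Fin.isValue, Matrix.mul_apply, Fin.sum_univ_two, Matrix.star_apply, Matrix.of_apply,
        Matrix.cons_val', Matrix.cons_val_zero, Matrix.cons_val_one, Matrix.empty_val', Matrix.cons_val_fin_one, Matrix.one_apply,
        Complex.star_def, map_mul, Complex.conj_ofReal, Complex.conj_I]
    · simp only [if_true]
      linear_combination hcs - ((Real.sin s : ℂ) * Real.sin s) * Complex.I_mul_I
    · simp; ring
    · simp; ring
    · simp only [if_true]
      linear_combination hcs - ((Real.sin s : ℂ) * Real.sin s) * Complex.I_mul_I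
  · rw [Matrix.det_fin_two_of]
    linear_combination hcs - ((Real.sin s : ℂ) * Real.sin s) * Complex.I_mul_I

/-- `D(s) ∈ SU(2)`. [folklore] -/
theorem D_mem (s : ℝ) :
    !![(Real.cos s : ℂ) + I * Real.sin s, 0; 0, (Real.cos s : ℂ) - I * Real.sin s] ∈ Matrix.specialUnitaryGroup (Fin 2) ℂ := by
  have hcs := cos_mul_cos_add_sin_mul_sin s
  rw [Matrix.mem_specialUnitaryGroup_iff, Matrix.mem_unitaryGroup_iff]
  refine ⟨?_, ?_⟩
  · ext i j
    fin_cases i <;> fin_cases j <;>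
      simp only [Fin.zero_eta, Fin.mk_one, Fin.isValue, Matrix.mul_apply, Fin.sum_univ_two, Matrix.star_apply, Matrix.of_apply,
        Matrix.cons_val', Matrix.cons_val_zero, Matrix.cons_val_one, Matrix.empty_val', Matrix.cons_val_fin_one, Matrix.one_apply,
        Complex.star_def, map_mul, map_add, map_sub, Complex.conj_ofReal, Complex.conj_I]
    · simp only [if_true]
      linear_combination hcs - ((Real.sin s : ℂ) * Real.sin s) * Complex.I_mul_I
    · simp
    · simp
    · simp only [if_true]
      linear_combination hcs - ((Real.sin s : ℂ) * Real.sin s) * Complex.I_mul_I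
  · rw [Matrix.det_fin_two_of]
    linear_combination hcs - ((Real.sin s : ℂ) * Real.sin s) * Complex.I_mul_I

/-- `P(0) = 1`. [folklore] -/
theorem P_zero : !![(Real.cos 0 : ℂ), I * Real.sin 0; I * Real.sin 0, (Real.cos 0 : ℂ)] = 1 := by
  rw [Real.cos_zero, Real.sin_zero, Matrix.one_fin_two]
  push_cast
  simp

/-- `D(0) = 1`. [folklore] -/
theorem D_zero : !![(Real.cos 0 : ℂ) + I * Real.sin 0, 0; 0, (Real.cos 0 : ℂ) - I * Real.sin 0] = 1 := by
  rw [Real.cos_zero, Real.sin_zero, Matrix.one_fin_two]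
  push_cast
  simp

/-- A `2 × 2` matrix with continuous entries is a continuous function of the parameter. [folklore] -/
theorem continuous_fin_two {f₀₀ f₀₁ f₁₀ f₁₁ : ℝ → ℂ} (h₀₀ : Continuous f₀₀) (h₀₁ : Continuous f₀₁) (h₁₀ : Continuous f₁₀) (h₁₁ : Continuous f₁₁) :
    Continuous fun s : ℝ => !![f₀₀ s, f₀₁ s; f₁₀ s, f₁₁ s] := by
  refine continuous_pi fun i => continuous_pi fun j => ?_
  fin_cases i <;> fin_cases j <;> simpa

/-- `s ↦ P(s)` is continuous. [folklore] -/
theorem continuous_P : Continuous fun s : ℝ => !![(Real.cos s : ℂ), I * Real.sin s; I * Real.sin s, (Real.cos s : ℂ)] :=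
  continuous_fin_two (Complex.continuous_ofReal.comp Real.continuous_cos) (continuous_const.mul (Complex.continuous_ofReal.comp Real.continuous_sin))
    (continuous_const.mul (Complex.continuous_ofReal.comp Real.continuous_sin)) (Complex.continuous_ofReal.comp Real.continuous_cos)

/-- `s ↦ D(s)` is continuous. [folklore] -/
theorem continuous_D : Continuous fun s : ℝ => !![(Real.cos s : ℂ) + I * Real.sin s, 0; 0, (Real.cos s : ℂ) - I * Real.sin s] :=
  continuous_fin_two ((Complex.continuous_ofReal.comp Real.continuous_cos).add (continuous_const.mul (Complex.continuous_ofReal.comp Real.continuous_sin)))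
    continuous_const continuous_const
    ((Complex.continuous_ofReal.comp Real.continuous_cos).sub (continuous_const.mul (Complex.continuous_ofReal.comp Real.continuous_sin)))

/-- `I · sin s ≠ 0` for `sin s ≠ 0`. [folklore] -/
theorem I_mul_sin_ne_zero {s : ℝ} (hs : Real.sin s ≠ 0) : I * (Real.sin s : ℂ) ≠ 0 :=
  mul_ne_zero Complex.I_ne_zero (by exact_mod_cast hs)

/-- **`D(s)` AND `P(s)` DO NOT COMMUTE** for `sin s ≠ 0` (the `(0,1)` entries differ by `2·I²·sin²s`). [folklore] -/
theorem D_mul_P_ne_P_mul_D {s : ℝ} (hs : Real.sin s ≠ 0) :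
    !![(Real.cos s : ℂ) + I * Real.sin s, 0; 0, (Real.cos s : ℂ) - I * Real.sin s] * !![(Real.cos s : ℂ), I * Real.sin s; I * Real.sin s, (Real.cos s : ℂ)] ≠
      !![(Real.cos s : ℂ), I * Real.sin s; I * Real.sin s, (Real.cos s : ℂ)] * !![(Real.cos s : ℂ) + I * Real.sin s, 0; 0, (Real.cos s : ℂ) - I * Real.sin s] := by
  intro h
  have h01 := congrFun (congrFun h 0) 1
  simp only [mul_apply_two, Matrix.of_apply, Matrix.cons_val', Matrix.cons_val_zero, Matrix.cons_val_one, Matrix.empty_val', Matrix.cons_val_fin_one] at h01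
  have hsq : (Real.sin s : ℂ) * Real.sin s = 0 := by
    linear_combination (-1 / 2 : ℂ) * h01 + ((Real.sin s : ℂ) * Real.sin s) * Complex.I_mul_I
  have : (Real.sin s : ℂ) = 0 := mul_self_eq_zero.mp hsq
  exact hs (by exact_mod_cast this)

/-- **A MATRIX COMMUTING WITH `D(s)` IS DIAGONAL** (`sin s ≠ 0`, so the two eigenvalues `cos s ± I·sin s` differ). [folklore] -/
theorem offdiag_eq_zero_of_commute_D {s : ℝ} (hs : Real.sin s ≠ 0) {M : Matrix (Fin 2) (Fin 2) ℂ}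
    (h : M * !![(Real.cos s : ℂ) + I * Real.sin s, 0; 0, (Real.cos s : ℂ) - I * Real.sin s] =
      !![(Real.cos s : ℂ) + I * Real.sin s, 0; 0, (Real.cos s : ℂ) - I * Real.sin s] * M) : M 0 1 = 0 ∧ M 1 0 = 0 := by
  have h01 := congrFun (congrFun h 0) 1
  have h10 := congrFun (congrFun h 1) 0
  simp only [mul_apply_two, Matrix.of_apply, Matrix.cons_val', Matrix.cons_val_zero, Matrix.cons_val_one, Matrix.empty_val', Matrix.cons_val_fin_one,
    mul_zero, zero_mul, add_zero, zero_add] at h01 h10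
  have hI := I_mul_sin_ne_zero hs
  have h2 : (2 : ℂ) * (I * Real.sin s) ≠ 0 := mul_ne_zero two_ne_zero hI
  constructor
  · have : M 0 1 * (2 * (I * Real.sin s)) = 0 := by linear_combination -h01
    exact (mul_eq_zero.mp this).resolve_right h2
  · have : M 1 0 * (2 * (I * Real.sin s)) = 0 := by linear_combination h10
    exact (mul_eq_zero.mp this).resolve_right h2

/-- **A MATRIX COMMUTING WITH `P(s)` HAS EQUAL DIAGONAL AND EQUAL OFF-DIAGONAL ENTRIES** (`sin s ≠ 0`). [folklore] -/
theorem entries_of_commute_P {s : ℝ} (hs : Real.sin s ≠ 0) {M : Matrix (Fin 2) (Fin 2) ℂ}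
    (h : M * !![(Real.cos s : ℂ), I * Real.sin s; I * Real.sin s, (Real.cos s : ℂ)] = !![(Real.cos s : ℂ), I * Real.sin s; I * Real.sin s, (Real.cos s : ℂ)] * M) :
    M 0 0 = M 1 1 ∧ M 0 1 = M 1 0 := by
  have h00 := congrFun (congrFun h 0) 0
  have h01 := congrFun (congrFun h 0) 1
  simp only [mul_apply_two, Matrix.of_apply, Matrix.cons_val', Matrix.cons_val_zero, Matrix.cons_val_one, Matrix.empty_val', Matrix.cons_val_fin_one] at h00 h01
  have hI := I_mul_sin_ne_zero hs
  constructor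
  · have : (M 0 0 - M 1 1) * (I * Real.sin s) = 0 := by linear_combination h01
    exact sub_eq_zero.mp ((mul_eq_zero.mp this).resolve_right hI)
  · have : (M 0 1 - M 1 0) * (I * Real.sin s) = 0 := by linear_combination h00
    exact sub_eq_zero.mp ((mul_eq_zero.mp this).resolve_right hI)

/-- **A MATRIX COMMUTING WITH BOTH `P(s)` AND `D(s)` IS SCALAR** (`sin s ≠ 0`). [folklore] -/
theorem eq_smul_one_of_commute_P_D {s : ℝ} (hs : Real.sin s ≠ 0) {M : Matrix (Fin 2) (Fin 2) ℂ}
    (hP : M * !![(Real.cos s : ℂ), I * Real.sin s; I * Real.sin s, (Real.cos s : ℂ)] = !![(Real.cos s : ℂ), I * Real.sin s; I * Real.sin s, (Real.cos s : ℂ)] * M)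
    (hD : M * !![(Real.cos s : ℂ) + I * Real.sin s, 0; 0, (Real.cos s : ℂ) - I * Real.sin s] =
      !![(Real.cos s : ℂ) + I * Real.sin s, 0; 0, (Real.cos s : ℂ) - I * Real.sin s] * M) :
    M = M 0 0 • (1 : Matrix (Fin 2) (Fin 2) ℂ) :=
  eq_smul_one_of_entries (offdiag_eq_zero_of_commute_D hs hD).1 (offdiag_eq_zero_of_commute_D hs hD).2 (entries_of_commute_P hs hP).1.symm

/-! ## §3 ★★ Next to any pair in `SU(2)` there are non-commuting pairs, along continuous one-parameter families through `1` -/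

/-- Cancellation of a special-unitary factor: `X · h = 0 ⇒ X = 0`. [folklore] -/
theorem eq_zero_of_mul_su_eq_zero {X : Matrix (Fin 2) (Fin 2) ℂ} (h : Matrix.specialUnitaryGroup (Fin 2) ℂ)
    (hX : X * (h : Matrix (Fin 2) (Fin 2) ℂ) = 0) : X = 0 := by
  have hu : (h : Matrix (Fin 2) (Fin 2) ℂ) * star (h : Matrix (Fin 2) (Fin 2) ℂ) = 1 :=
    Matrix.mem_unitaryGroup_iff.mp (Matrix.mem_specialUnitaryGroup_iff.mp h.2).1
  calc X = X * ((h : Matrix (Fin 2) (Fin 2) ℂ) * star (h : Matrix (Fin 2) (Fin 2) ℂ)) := by rw [hu, mul_one]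
    _ = 0 := by rw [← mul_assoc, hX, zero_mul]

/-- A special-unitary scalar matrix `z·1` has `z ≠ 0`. [folklore] -/
theorem ne_zero_of_su_eq_smul_one (h : Matrix.specialUnitaryGroup (Fin 2) ℂ) {z : ℂ}
    (hz : (h : Matrix (Fin 2) (Fin 2) ℂ) = z • (1 : Matrix (Fin 2) (Fin 2) ℂ)) : z ≠ 0 := by
  intro h0
  have hu : (h : Matrix (Fin 2) (Fin 2) ℂ) * star (h : Matrix (Fin 2) (Fin 2) ℂ) = 1 :=
    Matrix.mem_unitaryGroup_iff.mp (Matrix.mem_specialUnitaryGroup_iff.mp h.2).1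
  rw [hz, h0, zero_smul, zero_mul] at hu
  exact zero_ne_one hu

/-- `0 < s < 1 ⇒ sin s ≠ 0`. [folklore] -/
theorem sin_ne_zero_of_mem_Ioo {s : ℝ} (h0 : 0 < s) (h1 : s < 1) : Real.sin s ≠ 0 :=
  (Real.sin_pos_of_pos_of_lt_pi h0 (by linarith [Real.pi_gt_three])).ne'

/-- ★★ **NEXT TO ANY PAIR `h₁, h₂ ∈ SU(2)` THERE ARE NON-COMMUTING PAIRS**: there are continuous `r₁, r₂ : ℝ → SU(2)` with `r₁(0) = r₂(0) = 1` such that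
`(r₁(s)·h₁)·(r₂(s)·h₂) ≠ (r₂(s)·h₂)·(r₁(s)·h₁)` for every `s ∈ (0, 1)` (each `rᵢ` is one of `1`, `P`, `D`; six-way case split on `[h₁, h₂]` and the
`P`∕`D`-commutation types of `h₂`, `h₁`). [folklore] -/
theorem exists_nonCommuting_near (h₁ h₂ : Matrix.specialUnitaryGroup (Fin 2) ℂ) :
    ∃ r₁ r₂ : ℝ → Matrix.specialUnitaryGroup (Fin 2) ℂ, Continuous r₁ ∧ Continuous r₂ ∧ r₁ 0 = 1 ∧ r₂ 0 = 1 ∧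
      ∀ s : ℝ, 0 < s → s < 1 →
        (r₁ s : Matrix (Fin 2) (Fin 2) ℂ) * (h₁ : Matrix (Fin 2) (Fin 2) ℂ) * ((r₂ s : Matrix (Fin 2) (Fin 2) ℂ) * (h₂ : Matrix (Fin 2) (Fin 2) ℂ)) ≠
          (r₂ s : Matrix (Fin 2) (Fin 2) ℂ) * (h₂ : Matrix (Fin 2) (Fin 2) ℂ) * ((r₁ s : Matrix (Fin 2) (Fin 2) ℂ) * (h₁ : Matrix (Fin 2) (Fin 2) ℂ)) := by
  -- the three families as `SU(2)`-valued continuous paths through `1`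
  set one : ℝ → Matrix.specialUnitaryGroup (Fin 2) ℂ := fun _ => 1 with hone
  set Pf : ℝ → Matrix.specialUnitaryGroup (Fin 2) ℂ := fun s => ⟨_, P_mem s⟩ with hPf
  set Df : ℝ → Matrix.specialUnitaryGroup (Fin 2) ℂ := fun s => ⟨_, D_mem s⟩ with hDf
  have c_one : Continuous one := continuous_const
  have c_P : Continuous Pf := continuous_P.subtype_mk _
  have c_D : Continuous Df := continuous_D.subtype_mk _
  have one0 : one 0 = 1 := rfl
  have P0 : Pf 0 = 1 := Subtype.ext P_zero
  have D0 : Df 0 = 1 := Subtype.ext D_zero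
  have one_coe : ∀ s, ((one s : Matrix.specialUnitaryGroup (Fin 2) ℂ) : Matrix (Fin 2) (Fin 2) ℂ) = 1 := fun _ => rfl
  have P_coe : ∀ s, ((Pf s : Matrix.specialUnitaryGroup (Fin 2) ℂ) : Matrix (Fin 2) (Fin 2) ℂ) =
      !![(Real.cos s : ℂ), I * Real.sin s; I * Real.sin s, (Real.cos s : ℂ)] := fun _ => rfl
  have D_coe : ∀ s, ((Df s : Matrix.specialUnitaryGroup (Fin 2) ℂ) : Matrix (Fin 2) (Fin 2) ℂ) =
      !![(Real.cos s : ℂ) + I * Real.sin s, 0; 0, (Real.cos s : ℂ) - I * Real.sin s] := fun _ => rfl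
  set H₁ : Matrix (Fin 2) (Fin 2) ℂ := (h₁ : Matrix (Fin 2) (Fin 2) ℂ) with hH₁
  set H₂ : Matrix (Fin 2) (Fin 2) ℂ := (h₂ : Matrix (Fin 2) (Fin 2) ℂ) with hH₂
  by_cases hAB : H₁ * H₂ ≠ H₂ * H₁
  · -- Case A: already non-commuting
    refine ⟨one, one, c_one, c_one, one0, one0, fun s _ _ => ?_⟩
    rw [one_coe s, one_mul, one_mul]
    exact hAB
  rw [not_ne_iff] at hAB
  by_cases hP₂ : ¬ (H₂ 0 0 = H₂ 1 1 ∧ H₂ 0 1 = H₂ 1 0)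
  · -- Case B: `h₂` does not commute with `P(s)`; take `r₁ := P`, `r₂ := 1`
    refine ⟨Pf, one, c_P, c_one, P0, one0, fun s hs0 hs1 habs => hP₂ ?_⟩
    have hs := sin_ne_zero_of_mem_Ioo hs0 hs1
    rw [one_coe s, one_mul, P_coe s] at habs
    -- `P H₁ H₂ = H₂ P H₁` and `H₁ H₂ = H₂ H₁` ⇒ `(P H₂ − H₂ P) H₁ = 0`
    refine entries_of_commute_P hs (Eq.symm (sub_eq_zero.mp (eq_zero_of_mul_su_eq_zero h₁ ?_)))
    rw [sub_mul]
    calc _ = !![(Real.cos s : ℂ), I * Real.sin s; I * Real.sin s, (Real.cos s : ℂ)] * (H₁ * H₂) - H₂ * !![(Real.cos s : ℂ), I * Real.sin s; I * Real.sin s, (Real.cos s : ℂ)] * H₁ := by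
          rw [hAB, ← mul_assoc]
      _ = 0 := by rw [← mul_assoc, habs, ← mul_assoc, sub_self]
  rw [not_not] at hP₂
  by_cases hD₂ : ¬ (H₂ 0 1 = 0 ∧ H₂ 1 0 = 0)
  · -- Case C: `h₂` does not commute with `D(s)`; take `r₁ := D`, `r₂ := 1`
    refine ⟨Df, one, c_D, c_one, D0, one0, fun s hs0 hs1 habs => hD₂ ?_⟩
    have hs := sin_ne_zero_of_mem_Ioo hs0 hs1
    rw [one_coe s, one_mul, D_coe s] at habs
    refine offdiag_eq_zero_of_commute_D hs (Eq.symm (sub_eq_zero.mp (eq_zero_of_mul_su_eq_zero h₁ ?_)))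
    rw [sub_mul]
    calc _ = !![(Real.cos s : ℂ) + I * Real.sin s, 0; 0, (Real.cos s : ℂ) - I * Real.sin s] * (H₁ * H₂) -
          H₂ * !![(Real.cos s : ℂ) + I * Real.sin s, 0; 0, (Real.cos s : ℂ) - I * Real.sin s] * H₁ := by rw [hAB, ← mul_assoc]
      _ = 0 := by rw [← mul_assoc, habs, ← mul_assoc, sub_self]
  rw [not_not] at hD₂
  -- `h₂` is scalar: `H₂ = z • 1`, `z ≠ 0`
  have hz : H₂ = H₂ 0 0 • (1 : Matrix (Fin 2) (Fin 2) ℂ) := eq_smul_one_of_entries hD₂.1 hD₂.2 hP₂.1.symm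
  have hz0 : H₂ 0 0 ≠ 0 := ne_zero_of_su_eq_smul_one h₂ hz
  by_cases hP₁ : ¬ (H₁ 0 0 = H₁ 1 1 ∧ H₁ 0 1 = H₁ 1 0)
  · -- Case D1: `h₁` does not commute with `P(s)`; take `r₁ := 1`, `r₂ := P`
    refine ⟨one, Pf, c_one, c_P, one0, P0, fun s hs0 hs1 habs => hP₁ ?_⟩
    have hs := sin_ne_zero_of_mem_Ioo hs0 hs1
    rw [one_coe s, one_mul, P_coe s, hz] at habs
    refine entries_of_commute_P hs ?_
    -- `H₁ (P (z•1)) = (P (z•1)) H₁` ⇒ `z • (H₁ P) = z • (P H₁)`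
    rw [mul_smul_comm, mul_one, mul_smul_comm, smul_mul_assoc] at habs
    exact smul_right_injective _ hz0 habs
  rw [not_not] at hP₁
  by_cases hD₁ : ¬ (H₁ 0 1 = 0 ∧ H₁ 1 0 = 0)
  · -- Case D2: `h₁` does not commute with `D(s)`; take `r₁ := 1`, `r₂ := D`
    refine ⟨one, Df, c_one, c_D, one0, D0, fun s hs0 hs1 habs => hD₁ ?_⟩
    have hs := sin_ne_zero_of_mem_Ioo hs0 hs1
    rw [one_coe s, one_mul, D_coe s, hz] at habs
    refine offdiag_eq_zero_of_commute_D hs ?_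
    rw [mul_smul_comm, mul_one, mul_smul_comm, smul_mul_assoc] at habs
    exact smul_right_injective _ hz0 habs
  rw [not_not] at hD₁
  -- Case D3: both scalar; take `r₁ := D`, `r₂ := P`, which do not commute
  have hw : H₁ = H₁ 0 0 • (1 : Matrix (Fin 2) (Fin 2) ℂ) := eq_smul_one_of_entries hD₁.1 hD₁.2 hP₁.1.symm
  have hw0 : H₁ 0 0 ≠ 0 := ne_zero_of_su_eq_smul_one h₁ hw
  refine ⟨Df, Pf, c_D, c_P, D0, P0, fun s hs0 hs1 habs => ?_⟩
  have hs := sin_ne_zero_of_mem_Ioo hs0 hs1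
  rw [D_coe s, P_coe s, hz, hw] at habs
  apply D_mul_P_ne_P_mul_D hs
  rw [mul_smul_comm, mul_one, mul_smul_comm, mul_one, smul_mul_assoc, mul_smul_comm, smul_mul_assoc, mul_smul_comm, smul_smul, smul_smul,
    mul_comm (H₂ 0 0) (H₁ 0 0)] at habs
  exact smul_right_injective _ (mul_ne_zero hw0 hz0) habs

end Summit.QuantumFields.YangMills.Theorems.Prop7SU2NonCommutingPairs

end
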